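import Summits.Ventures.CertifiedManyBodySolver.Downfold.EmeryAxialSlabTl2223IPWindows
import Summits.Ventures.CertifiedManyBodySolver.Downfold.EmeryFermiFillingTl2223IP
import Summits.Ventures.CertifiedManyBodySolver.Downfold.EmeryFermiFillingLa214
import Summits.Ventures.CertifiedManyBodySolver.Downfold.EmeryAxialConductionBand
import HarnessLib

/-!
# Tl₂Ba₂Ca₂Cu₃O₁₀ INNER plane (box #306 Tl-2223, (K) source rows): the axial co-shift census ON THE TYPED BOX `emeryBoxTl2223IPK11Src` — verdicts against the object-E row
# `t′/t ∈ [-0.447, -0.346]` and their FOUR-ORBITAL reading (companion of `EmeryAxialSlabTl2223IPWindows`, which carries the method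
# docstring, the slab table and the raw slab windows; the kernel certificates are in `EmeryAxialSlabTl2223IPSubs*`)

Venture CertifiedManyBodySolver, cell `pub/hubbard-downfold` (stage S1), seat hubbard-downfold-mod-4 (technique B); namespace
`Summit.Ventures.CertifiedManyBodySolver.Downfold.Emery`. Everything PROVED. READING (certified): `a ∈ [0, 0.02]` ⇒ the co-shifted Fermi surface is STILL LESS cuprate-like than the E row (`t′/t > -0.346`): the REQUIRED axial admixture at the Fermi level is `a_F > 0.02` eV (`emeryBoxTl2223IPK11Src_axial_short`).
WHAT THIS IS NOT: not a statement that the material's parameters ARE in the box (SCREENING-GRADE provenance); `U = 0` band kinematics; no phase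
sentence; the E row is a [float] literature refit; `a_F` is the ADDITIONAL admixture beyond the box's σ rows (a model-form distance).
Sources: [AndersenEtAl1995, §§5–6]; [PavariniEtAl2001, Eqs. (1)–(3), Fig. 3]; [HybertsenSchluterChristensen1989, Eq. (1)].
-/

noncomputable section

namespace Summit.Ventures.CertifiedManyBodySolver.Downfold.Emery

open Real Set
open Summit.Ventures.CertifiedManyBodySolver.Downfold

/-! ## §2 The typed box and the co-shift as a parameter -/

/-- The one-body rows and the per-spin filling of `emeryBoxTl2223IPK11Src` read by this file. [folklore] -/
theorem emeryBoxTl2223IPK11Src_axRows {p : EmeryCoord → ℝ} (hp : emeryBoxTl2223IPK11Src.Mem p) :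
    p .DeltaPd ∈ Set.Icc (37 / 25 : ℝ) (56 / 25 : ℝ) ∧ p .tpd ∈ Set.Icc (59 / 50 : ℝ) (139 / 100 : ℝ) ∧
      p .tpp ∈ Set.Icc (31 / 50 : ℝ) (73 / 100 : ℝ) ∧ p .tppP ∈ Set.Icc (3 / 20 : ℝ) (19 / 100 : ℝ) ∧
      (2 - p .nHoles) / 2 ∈ Set.Icc (41 / 100 : ℝ) (43 / 100 : ℝ) := by
  obtain ⟨hΔ, ha, hb, hc, hn⟩ := emeryBoxTl2223IPK11Src_mem_rows hp
  exact ⟨hΔ, ha, hb, hc, abFilling_rowTl1223OP_of_nHoles hn.1 hn.2 rfl⟩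

/-- **Slab 0 on the typed box**: for every parameter vector of `emeryBoxTl2223IPK11Src`, every co-shift `a ∈ [0, 0.02]` and every Fermi energy at
which the CO-SHIFTED σ antibonding band holds the box's electrons: `ε ∈ [1.18, 2.3]`, `t′/t ∈ [-0.3458, -0.2564]` (SHORT).
[folklore] -/
theorem emeryBoxTl2223IPK11Src_axSlab0 :
    HoldsOn (fun p : EmeryCoord → ℝ => ∀ a ε : ℝ, a ∈ Set.Icc (0 : ℝ) (1 / 50 : ℝ) →
      abFilling (p .DeltaPd) (p .tpd) (p .tpp + a) (p .tppP + a) ε = (2 - p .nHoles) / 2 →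
      ε ∈ Set.Icc (59 / 50 : ℝ) (23 / 10 : ℝ) ∧
      fsRatio (p .DeltaPd) (p .tpd) (p .tpp + a) (p .tppP + a) ε ∈ Set.Icc (-(1729 / 5000 : ℝ)) (-(641 / 2500 : ℝ))) emeryBoxTl2223IPK11Src := by
  intro p hp a ε ha' hf
  obtain ⟨hΔ, ha, hb, hc, hν⟩ := emeryBoxTl2223IPK11Src_axRows hp
  rw [← hf] at hν
  exact tl2223IPAxSlab0_window hΔ ha ⟨by linarith [hb.1, ha'.1], by linarith [hb.2, ha'.2]⟩
    ⟨by linarith [hc.1, ha'.1], by linarith [hc.2, ha'.2]⟩ hν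

/-- **Slab 1 on the typed box**: for every parameter vector of `emeryBoxTl2223IPK11Src`, every co-shift `a ∈ [0.02, 0.05]` and every Fermi energy at
which the CO-SHIFTED σ antibonding band holds the box's electrons: `ε ∈ [1.16, 2.3]`, `t′/t ∈ [-0.3592, -0.2659]` (MEETS).
[folklore] -/
theorem emeryBoxTl2223IPK11Src_axSlab1 :
    HoldsOn (fun p : EmeryCoord → ℝ => ∀ a ε : ℝ, a ∈ Set.Icc (1 / 50 : ℝ) (1 / 20 : ℝ) →
      abFilling (p .DeltaPd) (p .tpd) (p .tpp + a) (p .tppP + a) ε = (2 - p .nHoles) / 2 →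
      ε ∈ Set.Icc (29 / 25 : ℝ) (23 / 10 : ℝ) ∧
      fsRatio (p .DeltaPd) (p .tpd) (p .tpp + a) (p .tppP + a) ε ∈ Set.Icc (-(449 / 1250 : ℝ)) (-(2659 / 10000 : ℝ))) emeryBoxTl2223IPK11Src := by
  intro p hp a ε ha' hf
  obtain ⟨hΔ, ha, hb, hc, hν⟩ := emeryBoxTl2223IPK11Src_axRows hp
  rw [← hf] at hν
  exact tl2223IPAxSlab1_window hΔ ha ⟨by linarith [hb.1, ha'.1], by linarith [hb.2, ha'.2]⟩
    ⟨by linarith [hc.1, ha'.1], by linarith [hc.2, ha'.2]⟩ hν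

/-- **Slab 2 on the typed box**: for every parameter vector of `emeryBoxTl2223IPK11Src`, every co-shift `a ∈ [0.05, 0.1]` and every Fermi energy at
which the CO-SHIFTED σ antibonding band holds the box's electrons: `ε ∈ [1.14, 2.28]`, `t′/t ∈ [-0.3799, -0.2798]` (MEETS).
[folklore] -/
theorem emeryBoxTl2223IPK11Src_axSlab2 :
    HoldsOn (fun p : EmeryCoord → ℝ => ∀ a ε : ℝ, a ∈ Set.Icc (1 / 20 : ℝ) (1 / 10 : ℝ) →
      abFilling (p .DeltaPd) (p .tpd) (p .tpp + a) (p .tppP + a) ε = (2 - p .nHoles) / 2 →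
      ε ∈ Set.Icc (57 / 50 : ℝ) (57 / 25 : ℝ) ∧
      fsRatio (p .DeltaPd) (p .tpd) (p .tpp + a) (p .tppP + a) ε ∈ Set.Icc (-(3799 / 10000 : ℝ)) (-(1399 / 5000 : ℝ))) emeryBoxTl2223IPK11Src := by
  intro p hp a ε ha' hf
  obtain ⟨hΔ, ha, hb, hc, hν⟩ := emeryBoxTl2223IPK11Src_axRows hp
  rw [← hf] at hν
  exact tl2223IPAxSlab2_window hΔ ha ⟨by linarith [hb.1, ha'.1], by linarith [hb.2, ha'.2]⟩
    ⟨by linarith [hc.1, ha'.1], by linarith [hc.2, ha'.2]⟩ hν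

/-- **Slab 3 on the typed box**: for every parameter vector of `emeryBoxTl2223IPK11Src`, every co-shift `a ∈ [0.1, 0.2]` and every Fermi energy at
which the CO-SHIFTED σ antibonding band holds the box's electrons: `ε ∈ [1.08, 2.28]`, `t′/t ∈ [-0.4184, -0.3]` (MEETS).
[folklore] -/
theorem emeryBoxTl2223IPK11Src_axSlab3 :
    HoldsOn (fun p : EmeryCoord → ℝ => ∀ a ε : ℝ, a ∈ Set.Icc (1 / 10 : ℝ) (1 / 5 : ℝ) →
      abFilling (p .DeltaPd) (p .tpd) (p .tpp + a) (p .tppP + a) ε = (2 - p .nHoles) / 2 →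
      ε ∈ Set.Icc (27 / 25 : ℝ) (57 / 25 : ℝ) ∧
      fsRatio (p .DeltaPd) (p .tpd) (p .tpp + a) (p .tppP + a) ε ∈ Set.Icc (-(523 / 1250 : ℝ)) (-(3 / 10 : ℝ))) emeryBoxTl2223IPK11Src := by
  intro p hp a ε ha' hf
  obtain ⟨hΔ, ha, hb, hc, hν⟩ := emeryBoxTl2223IPK11Src_axRows hp
  rw [← hf] at hν
  exact tl2223IPAxSlab3_window hΔ ha ⟨by linarith [hb.1, ha'.1], by linarith [hb.2, ha'.2]⟩
    ⟨by linarith [hc.1, ha'.1], by linarith [hc.2, ha'.2]⟩ hν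

/-- **Slab 4 on the typed box**: for every parameter vector of `emeryBoxTl2223IPK11Src`, every co-shift `a ∈ [0.2, 0.25]` and every Fermi energy at
which the CO-SHIFTED σ antibonding band holds the box's electrons: `ε ∈ [1.08, 2.22]`, `t′/t ∈ [-0.4319, -0.3314]` (MEETS).
[folklore] -/
theorem emeryBoxTl2223IPK11Src_axSlab4 :
    HoldsOn (fun p : EmeryCoord → ℝ => ∀ a ε : ℝ, a ∈ Set.Icc (1 / 5 : ℝ) (1 / 4 : ℝ) →
      abFilling (p .DeltaPd) (p .tpd) (p .tpp + a) (p .tppP + a) ε = (2 - p .nHoles) / 2 →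
      ε ∈ Set.Icc (27 / 25 : ℝ) (111 / 50 : ℝ) ∧
      fsRatio (p .DeltaPd) (p .tpd) (p .tpp + a) (p .tppP + a) ε ∈ Set.Icc (-(4319 / 10000 : ℝ)) (-(1657 / 5000 : ℝ))) emeryBoxTl2223IPK11Src := by
  intro p hp a ε ha' hf
  obtain ⟨hΔ, ha, hb, hc, hν⟩ := emeryBoxTl2223IPK11Src_axRows hp
  rw [← hf] at hν
  exact tl2223IPAxSlab4_window hΔ ha ⟨by linarith [hb.1, ha'.1], by linarith [hb.2, ha'.2]⟩
    ⟨by linarith [hc.1, ha'.1], by linarith [hc.2, ha'.2]⟩ hν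

/-- **Slab 5 on the typed box**: for every parameter vector of `emeryBoxTl2223IPK11Src`, every co-shift `a ∈ [0.25, 0.3]` and every Fermi energy at
which the CO-SHIFTED σ antibonding band holds the box's electrons: `ε ∈ [1.08, 2.18]`, `t′/t ∈ [-0.4464, -0.3448]` (MEETS).
[folklore] -/
theorem emeryBoxTl2223IPK11Src_axSlab5 :
    HoldsOn (fun p : EmeryCoord → ℝ => ∀ a ε : ℝ, a ∈ Set.Icc (1 / 4 : ℝ) (3 / 10 : ℝ) →
      abFilling (p .DeltaPd) (p .tpd) (p .tpp + a) (p .tppP + a) ε = (2 - p .nHoles) / 2 →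
      ε ∈ Set.Icc (27 / 25 : ℝ) (109 / 50 : ℝ) ∧
      fsRatio (p .DeltaPd) (p .tpd) (p .tpp + a) (p .tppP + a) ε ∈ Set.Icc (-(279 / 625 : ℝ)) (-(431 / 1250 : ℝ))) emeryBoxTl2223IPK11Src := by
  intro p hp a ε ha' hf
  obtain ⟨hΔ, ha, hb, hc, hν⟩ := emeryBoxTl2223IPK11Src_axRows hp
  rw [← hf] at hν
  exact tl2223IPAxSlab5_window hΔ ha ⟨by linarith [hb.1, ha'.1], by linarith [hb.2, ha'.2]⟩
    ⟨by linarith [hc.1, ha'.1], by linarith [hc.2, ha'.2]⟩ hν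

/-- **Slab 6 on the typed box**: for every parameter vector of `emeryBoxTl2223IPK11Src`, every co-shift `a ∈ [0.3, 0.35]` and every Fermi energy at
which the CO-SHIFTED σ antibonding band holds the box's electrons: `ε ∈ [1.06, 2.16]`, `t′/t ∈ [-0.4595, -0.3573]` (MEETS).
[folklore] -/
theorem emeryBoxTl2223IPK11Src_axSlab6 :
    HoldsOn (fun p : EmeryCoord → ℝ => ∀ a ε : ℝ, a ∈ Set.Icc (3 / 10 : ℝ) (7 / 20 : ℝ) →
      abFilling (p .DeltaPd) (p .tpd) (p .tpp + a) (p .tppP + a) ε = (2 - p .nHoles) / 2 →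
      ε ∈ Set.Icc (53 / 50 : ℝ) (54 / 25 : ℝ) ∧
      fsRatio (p .DeltaPd) (p .tpd) (p .tpp + a) (p .tppP + a) ε ∈ Set.Icc (-(919 / 2000 : ℝ)) (-(3573 / 10000 : ℝ))) emeryBoxTl2223IPK11Src := by
  intro p hp a ε ha' hf
  obtain ⟨hΔ, ha, hb, hc, hν⟩ := emeryBoxTl2223IPK11Src_axRows hp
  rw [← hf] at hν
  exact tl2223IPAxSlab6_window hΔ ha ⟨by linarith [hb.1, ha'.1], by linarith [hb.2, ha'.2]⟩
    ⟨by linarith [hc.1, ha'.1], by linarith [hc.2, ha'.2]⟩ hν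

/-- **Slab 7 on the typed box**: for every parameter vector of `emeryBoxTl2223IPK11Src`, every co-shift `a ∈ [0.35, 0.4]` and every Fermi energy at
which the CO-SHIFTED σ antibonding band holds the box's electrons: `ε ∈ [1.04, 2.16]`, `t′/t ∈ [-0.4715, -0.3684]` (MEETS).
[folklore] -/
theorem emeryBoxTl2223IPK11Src_axSlab7 :
    HoldsOn (fun p : EmeryCoord → ℝ => ∀ a ε : ℝ, a ∈ Set.Icc (7 / 20 : ℝ) (2 / 5 : ℝ) →
      abFilling (p .DeltaPd) (p .tpd) (p .tpp + a) (p .tppP + a) ε = (2 - p .nHoles) / 2 →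
      ε ∈ Set.Icc (26 / 25 : ℝ) (54 / 25 : ℝ) ∧
      fsRatio (p .DeltaPd) (p .tpd) (p .tpp + a) (p .tppP + a) ε ∈ Set.Icc (-(943 / 2000 : ℝ)) (-(921 / 2500 : ℝ))) emeryBoxTl2223IPK11Src := by
  intro p hp a ε ha' hf
  obtain ⟨hΔ, ha, hb, hc, hν⟩ := emeryBoxTl2223IPK11Src_axRows hp
  rw [← hf] at hν
  exact tl2223IPAxSlab7_window hΔ ha ⟨by linarith [hb.1, ha'.1], by linarith [hb.2, ha'.2]⟩
    ⟨by linarith [hc.1, ha'.1], by linarith [hc.2, ha'.2]⟩ hν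

/-- **Slab 8 on the typed box**: for every parameter vector of `emeryBoxTl2223IPK11Src`, every co-shift `a ∈ [0.4, 0.5]` and every Fermi energy at
which the CO-SHIFTED σ antibonding band holds the box's electrons: `ε ∈ [1.02, 2.16]`, `t′/t ∈ [-0.4955, -0.3779]` (MEETS).
[folklore] -/
theorem emeryBoxTl2223IPK11Src_axSlab8 :
    HoldsOn (fun p : EmeryCoord → ℝ => ∀ a ε : ℝ, a ∈ Set.Icc (2 / 5 : ℝ) (1 / 2 : ℝ) →
      abFilling (p .DeltaPd) (p .tpd) (p .tpp + a) (p .tppP + a) ε = (2 - p .nHoles) / 2 →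
      ε ∈ Set.Icc (51 / 50 : ℝ) (54 / 25 : ℝ) ∧
      fsRatio (p .DeltaPd) (p .tpd) (p .tpp + a) (p .tppP + a) ε ∈ Set.Icc (-(991 / 2000 : ℝ)) (-(3779 / 10000 : ℝ))) emeryBoxTl2223IPK11Src := by
  intro p hp a ε ha' hf
  obtain ⟨hΔ, ha, hb, hc, hν⟩ := emeryBoxTl2223IPK11Src_axRows hp
  rw [← hf] at hν
  exact tl2223IPAxSlab8_window hΔ ha ⟨by linarith [hb.1, ha'.1], by linarith [hb.2, ha'.2]⟩
    ⟨by linarith [hc.1, ha'.1], by linarith [hc.2, ha'.2]⟩ hν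

/-! ## §3 The census verdicts against the E row -/

/-- **STILL SHORT OF THE E ROW for every co-shift `a ∈ [0, 0.02]`**: the co-shifted σ (= four-orbital at the Fermi level) `t′/t` stays ABOVE
`-0.346` — the one-band Fermi surface of record REQUIRES an axial admixture `a_F > 0.02` eV beyond the box's σ rows. [folklore] -/
theorem emeryBoxTl2223IPK11Src_axial_short :
    HoldsOn (fun p : EmeryCoord → ℝ => ∀ a ε : ℝ, a ∈ Set.Icc (0 : ℝ) (1 / 50 : ℝ) →
      abFilling (p .DeltaPd) (p .tpd) (p .tpp + a) (p .tppP + a) ε = (2 - p .nHoles) / 2 →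
      (-(173 / 500 : ℝ)) < fsRatio (p .DeltaPd) (p .tpd) (p .tpp + a) (p .tppP + a) ε) emeryBoxTl2223IPK11Src := by
  intro p hp a ε ha' hf
  have h := (emeryBoxTl2223IPK11Src_axSlab0 p hp a ε ha' hf).2
  exact lt_of_lt_of_le (by norm_num) h.1

/-! ## §4 The four-orbital reading (transfer theorem `EmeryAxialConductionBand.condFilling_eq_abFilling`) -/

/-- **FOUR-ORBITAL FORM OF THE SHORTFALL.** For every parameter vector of `emeryBoxTl2223IPK11Src`, EVERY axial level `ε_s` and coupling `t_sp`, and every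
Fermi energy `ε < ε_s` at which the four-orbital CONDUCTION band (`EmeryBandEigenvalues.band4 … 1`) holds the box's electrons: if the axial admixture
at the Fermi level `t_sp²/(ε_s − ε)` is at most `0.02` eV, the conduction-band Fermi surface (an exact `t–t′` contour,
`EmeryAxialConductionBand.oneBand_of_band4_one_eq`) has `t′/t > -0.346` — it does NOT reproduce the object-E row. [cite: PavariniEtAl2001, Eqs. (1)–(3), Fig. 3] -/
theorem emeryBoxTl2223IPK11Src_fourOrbital_short :
    HoldsOn (fun p : EmeryCoord → ℝ => ∀ εs tsp ε : ℝ, ε < εs →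
      tsp ^ 2 / (εs - ε) ≤ (1 / 50 : ℝ) →
      condFilling (p .DeltaPd) εs (p .tpd) (p .tpp) (p .tppP) tsp ε = (2 - p .nHoles) / 2 →
      (-(173 / 500 : ℝ)) < fsRatio (p .DeltaPd) (p .tpd) (p .tpp + tsp ^ 2 / (εs - ε)) (p .tppP + tsp ^ 2 / (εs - ε)) ε) emeryBoxTl2223IPK11Src := by
  intro p hp εs tsp ε hε ha hf
  rw [condFilling_eq_abFilling hε] at hf
  exact emeryBoxTl2223IPK11Src_axial_short p hp _ ε ⟨div_nonneg (sq_nonneg _) (sub_pos.mpr hε).le, ha⟩ hf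

end Summit.Ventures.CertifiedManyBodySolver.Downfold.Emery
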